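import Summits.QuantumFields.BalabanUV.Beta.FP.PerfectGaugeDefectBottomDressed
import Summits.QuantumFields.BalabanUV.Beta.FP.NestedDressingLinear

/-!
# `BalabanUV.Beta.FP.NestedDressingFineLeg` — road «FP» for binder row D1, W-ORACLE-K row **SPLIT, part (ii) «N-FINE» FOR THE FIELD LEGS** (owner d1-p3 gen 15, memo
# `HOME/b2b-balaban-beta-d1-p3/N2B-DESIGN.md` v3.1 §11 (11b) (ii); journal [D1P3-G15-WORACLEK]): **ON A `𝒬_{Lc}`-KILLED LEG THE NESTED PROJECTOR IS THE LITERAL's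
# ONE-STEP PROJECTOR** — `Π^{(m+1)}_nest A = Π^{(1)}_nest A (= Π̂₁ A)` whenever `contourSum Lc A = 0` (FILE 1), read on kernel legs through FILE 7: at EVERY finite `j` the
# left ∕ two-sided `piKSymNest (toSite r) Lc (m+1)`-dressing of the rescaled one-step resolvent `U_j KTot_{(j,1)}` agrees on its FIELD legs with the `piKSymNest … 1`-dressing
# (`𝒬Γ = 0`: `KKTFluctuationKernel.Gam_Q` + the semigroup of block-contour sums), HENCE — by gan24-leaf-05's limit lemmas — **for the PERFECT one-step resolvent:
# `[Π̂_{m+1}·KPerf 1]_{f·} = [Π̂₁·KPerf 1]_{f·}` on field columns and `[Π̂_{m+1}·KPerf 1·Π̂_{m+1}ᵀ]_ff = [Π̂₁·KPerf 1·Π̂₁ᵀ]_ff`, UNCONDITIONALLY** (`d + 1 = 4`, `Lc ≥ 2`)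

HONEST DEPENDENCY (page 1, mandatory): continuum YM on T⁴ ⇐ BetaPertH ∧ nine spine estimates (0/9 proved); BetaPertH ⇐ (D1) ∧ (D4) ∧ CAP+tail;
G-an2-4 gates asym, D1 and NE2/3/4.  HONEST FRAMING (cell contract, verbatim): «discharging `BetaPertH` makes Bałaban's UV stability UNCONDITIONAL —
a real constructive-QFT result; it is NOT the continuum limit and NOT the Clay problem.»  THIS MODULE is [folklore] finite sums over LANDED rows: this lineage's FILE 1
`symAxProjNestAt_succ_of_contourSum_eq_zero` ∕ `symAxProjNestAt_one`, FILE 7 `symAxProjNestAt_eq_coProjNestAt`, gan24-leaf-05's `dressNestLeft_apply` ∕ `coDressNest_ff_apply` ∕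
`dressNestLeft_KPerf_one_eq_holds` ∕ `coDressNest_KPerf_one_ff_eq_holds`, `Gam_Q`, `contourSum_mul`, `sum_LegIdx_eq_contourSum`.  No `def`, no `def … : Prop`, nothing cited,
nothing of Bałaban's asserted, 0 sorry; 0 estimates of Bałaban's constrained objects; 0∕4 row-D1 binders; NOT the MULTIPLIER columns (`𝒬ℋ = 1`: that is (iii) «N-DESC», next
file), NOT `G_N = G₁ + G_c`, NOT (SDF), NOT D1, NOT `BetaPertH`, NOT continuum, NOT Clay.  «not in print; our bookkeeping».

ABSOLUTE RULE (cell charter, verbatim): «No internally-minted statement may enter as a cited fact. Every hypothesis is either kernel-proved in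
this package or a verbatim quotation of a PUBLISHED theorem with page reference. The manuscript(s) under audit are NOT citable for their own
disputed steps — they are the thing under adjudication; programme-internal (2001/route/tribunal) claims are never citable.»

WHY (§11 (11b) (ii)).  `G_N := coDress_{Π^{(m+1)}} (KPerf (m+1))`; its `KPerf 1` part must be read with the literal's ONE-STEP projector `Π̂₁` so that the `G₁`-words of
leaf-06's `hessKer_add_kernel_words` are the one-step words (row TRANSPORT).  `Π^{(m+1)}_nest = Π̂₁ + (coarse gauge of 𝒬̄_{Lc}(·))`, so the two agree on every leg killed by the
straight block averaging — the FIELD legs of the fluctuation covariance (`𝒬Γ = 0`) — and differ on the MULTIPLIER columns (`𝒬ℋ = 1`, row (iii)).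

CONTENT (generic `d`; `1 ≤ Lc`, in-block root `r ∈ box (d+1) Lc` where stated).
* §1 Form level: **`symAxProjNestAt_succ_eq_one_of_contourSum_eq_zero`** (`contourSum Lc A = 0 ⇒ Π^{(m+1)} A = Π^{(1)} A`); kernel legs: **`dressNestLeft_eq_symAxProjNestAt`**
  (`[Π̂_M·K](x,y′; inl a, f′) = (Π^{(M)} K(·, y′; ·, f′))_a(x)`), **`dressNestLeft_succ_eq_one_of_contourSum`** (left dressings by `Π̂_{m+1}` and `Π̂₁` agree on a `𝒬`-killed first leg),
  **`coDressNest_ff_succ_eq_one_of_contourSum`** (two-sided, both legs `𝒬`-killed).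
* §2 The one-step resolvent's field legs are `𝒬_{Lc}`-killed on the step-`j` lattice: `contourSum_KTot_one_fst_eq_zero` ∕ `_snd_` (every `j`, generic units `unitK uf um`).
* §3 **`dressNestLeft_unitKTot_one_succ_eq`**, **`coDressNest_unitKTot_one_succ_ff_eq`** (EVERY `j`) and the PERFECT corollaries (`d + 1 = 4`, `Lc ≥ 2`)
  **`dressNestLeft_KPerf_one_succ_eq`** ∕ **`coDressNest_KPerf_one_succ_ff_eq`** (also with `piKSymBm` on the right by FILE 4 `piKSymNest_one`).
Unit `b2b-balaban-beta-d1-formalise-leaf-06` (gen 15), road «FP» row SPLIT (ii) (journal ONLINE 2026-08-21 l.34992, PLAN (1)).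
-/

noncomputable section

namespace Summit.QuantumFields.BalabanUV.Beta.FP.NestedDressingFineLeg

open Finset Filter Topology
open scoped BigOperators
open Literature.MathematicalPhysics.QuantumFieldTheory
open Literature.MathematicalPhysics.QuantumFieldTheory.Balaban1983to89
open Literature.MathematicalPhysics.QuantumFieldTheory.Balaban1983to89.Beta
open AffineAveraging (Form0 Form1 Site box toSite contourSum)
open ExpKernelCalculus (MKer comp)
open OneStepResolventKernel (Fib KInv KInv_inl_inl)
open KKTFluctuationKernel (Gam Gam_Q)
open KKTFluctuationEnergy (Gcol Gam_symm)
open OneStepKernelFamily (legPt LegIdx)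
open StepDriftWitness (sum_LegIdx_eq_contourSum)
open ResolventComposition (contourSum_mul contourSum_finset_sum contourSum_const_mul)
open ResolventCompositionStepB (dec_inl_inl)
open Summit.QuantumFields.BalabanUV.Beta.TameKernelCalculus (trK)
open Summit.QuantumFields.BalabanUV.Beta.AxialDressingRooted (cube)
open Summit.QuantumFields.BalabanUV.Beta.HessKerDressedUnits (unitK unitK_apply legScale legScale_inl)
open Summit.QuantumFields.BalabanUV.Beta.GAN24.CombesThomas (sfStep smStep)
open Summit.QuantumFields.BalabanUV.Beta.SymmetrisedDressingKernel (piKSymBm)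
open Summit.QuantumFields.BalabanUV.Beta.FP.PerfectObjects (KTot)
open Summit.QuantumFields.BalabanUV.Beta.FP.PerfectObjectsT (KPerf)
open Summit.QuantumFields.BalabanUV.Beta.FP.NestedDressingProjector (symAxProjNestAt symAxProjNestAt_one symAxProjNestAt_succ_of_contourSum_eq_zero)
open Summit.QuantumFields.BalabanUV.Beta.FP.NestedDressingKernel (pmSymNest piKSymNest piKSymNest_one)
open Summit.QuantumFields.BalabanUV.Beta.FP.NestedDressingLinear (coProjNestAt symAxProjNestAt_eq_coProjNestAt)
open Summit.QuantumFields.BalabanUV.Beta.FP.PerfectGaugeDefectBottomDressed (window_reorder dressNestLeft_apply coDressNest_ff_apply dressNestLeft_KPerf_one_eq_holds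
  coDressNest_KPerf_one_ff_eq_holds)

variable {d : ℕ}

/-! ## §1 On `𝒬_{Lc}`-killed legs the nested projector is the one-step projector -/

section Form

/-- [folklore] **`contourSum Lc A = 0 ⇒ Π^{(m+1)}_nest A = Π^{(1)}_nest A`** (FILE 1 `symAxProjNestAt_succ_of_contourSum_eq_zero` + `symAxProjNestAt_one`; any root, any `Lc`). -/
theorem symAxProjNestAt_succ_eq_one_of_contourSum_eq_zero (ρ : Site (d + 1)) (Lc m : ℕ) {A : Form1 (d + 1) ℝ} (hA : contourSum Lc A = 0) :
    symAxProjNestAt ρ Lc (m + 1) A = symAxProjNestAt ρ Lc 1 A := by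
  rw [symAxProjNestAt_succ_of_contourSum_eq_zero ρ Lc m hA, symAxProjNestAt_one]

/-- [folklore] **THE LEFT DRESSING IS THE NESTED PROJECTOR ON THE FIRST LEG** (in-block root, `Lc ≥ 1`): `[Π̂_M·K](x, y′; inl a, f′) = (Π^{(M)}_nest (K(·, y′; ·, f′)))_a(x)`
(gan24-leaf-05's `dressNestLeft_apply` + FILE 7 `symAxProjNestAt_eq_coProjNestAt`). -/
theorem dressNestLeft_eq_symAxProjNestAt {Lc : ℕ} (hLc : 1 ≤ Lc) {r : Fin (d + 1) → ℕ} (hr : r ∈ box (d + 1) Lc) (M : ℕ) (K : MKer (d + 1) (Fib d))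
    (x y' : Site (d + 1)) (a : Fin (d + 1)) (f' : Fib d) :
    comp (trK (piKSymNest (toSite r) Lc M)) K x y' (Sum.inl a) f' = symAxProjNestAt (toSite r) Lc M (fun κ q => K q y' (Sum.inl κ) f') a x := by
  rw [dressNestLeft_apply, symAxProjNestAt_eq_coProjNestAt hLc hr]
  rfl

/-- [folklore] **LEFT DRESSINGS BY `Π̂_{m+1}` AND `Π̂₁` AGREE ON A `𝒬_{Lc}`-KILLED FIRST LEG** (in-block root, `Lc ≥ 1`): if `contourSum Lc (K(·, y′; ·, f′)) = 0` then
`[Π̂_{m+1}·K](x, y′; inl a, f′) = [Π̂₁·K](x, y′; inl a, f′)`. -/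
theorem dressNestLeft_succ_eq_one_of_contourSum {Lc : ℕ} (hLc : 1 ≤ Lc) {r : Fin (d + 1) → ℕ} (hr : r ∈ box (d + 1) Lc) (m : ℕ) (K : MKer (d + 1) (Fib d))
    (y' : Site (d + 1)) (f' : Fib d) (hK : contourSum Lc (fun κ q => K q y' (Sum.inl κ) f') = 0) (x : Site (d + 1)) (a : Fin (d + 1)) :
    comp (trK (piKSymNest (toSite r) Lc (m + 1))) K x y' (Sum.inl a) f' = comp (trK (piKSymNest (toSite r) Lc 1)) K x y' (Sum.inl a) f' := by
  rw [dressNestLeft_eq_symAxProjNestAt hLc hr, dressNestLeft_eq_symAxProjNestAt hLc hr, symAxProjNestAt_succ_eq_one_of_contourSum_eq_zero _ _ _ hK]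

/-- [folklore] The straight block averaging of a left-dressed kernel in its SECOND (field) leg is the left-dressing of the averaged legs (finite window sums commute with
`contourSum`): if every second field leg of `K` is `𝒬_{Lc}`-killed, so is every second field leg of `Π̂_M·K`. -/
theorem contourSum_dressNestLeft_snd_eq_zero (ρ : Site (d + 1)) (Lc M : ℕ) (K : MKer (d + 1) (Fib d))
    (hK : ∀ (x' : Site (d + 1)) (κ : Fin (d + 1)), contourSum Lc (fun l q => K x' q (Sum.inl κ) (Sum.inl l)) = 0) (x : Site (d + 1)) (a : Fin (d + 1)) :
    contourSum Lc (fun l q => comp (trK (piKSymNest ρ Lc M)) K x q (Sum.inl a) (Sum.inl l)) = 0 := by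
  funext l Y
  have e : (fun l q => comp (trK (piKSymNest ρ Lc M)) K x q (Sum.inl a) (Sum.inl l))
      = fun l q => ∑ v ∈ cube (d + 1) (Lc ^ M), ∑ κ : Fin (d + 1), pmSymNest ρ Lc M a x κ (x - v) * K (x - v) q (Sum.inl κ) (Sum.inl l) := by
    funext l q; rw [dressNestLeft_apply]
  rw [e, contourSum_finset_sum]
  simp only [contourSum_finset_sum, contourSum_const_mul]
  refine Finset.sum_eq_zero fun v _ => Finset.sum_eq_zero fun κ _ => ?_
  rw [hK (x - v) κ]
  simp

/-- [folklore] **TWO-SIDED: CO-DRESSINGS BY `Π̂_{m+1}` AND `Π̂₁` AGREE ON THE FIELD–FIELD BLOCK OF A KERNEL WHOSE FIELD LEGS ARE BOTH `𝒬_{Lc}`-KILLED**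
(in-block root, `Lc ≥ 1`): `[Π̂_{m+1}·K·Π̂_{m+1}ᵀ](x, z; inl a, inl b) = [Π̂₁·K·Π̂₁ᵀ](x, z; inl a, inl b)`. -/
theorem coDressNest_ff_succ_eq_one_of_contourSum {Lc : ℕ} (hLc : 1 ≤ Lc) {r : Fin (d + 1) → ℕ} (hr : r ∈ box (d + 1) Lc) (m : ℕ) (K : MKer (d + 1) (Fib d))
    (hK₁ : ∀ (y' : Site (d + 1)) (l : Fin (d + 1)), contourSum Lc (fun κ q => K q y' (Sum.inl κ) (Sum.inl l)) = 0)
    (hK₂ : ∀ (x' : Site (d + 1)) (κ : Fin (d + 1)), contourSum Lc (fun l q => K x' q (Sum.inl κ) (Sum.inl l)) = 0)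
    (x z : Site (d + 1)) (a b : Fin (d + 1)) :
    comp (comp (trK (piKSymNest (toSite r) Lc (m + 1))) K) (piKSymNest (toSite r) Lc (m + 1)) x z (Sum.inl a) (Sum.inl b)
      = comp (comp (trK (piKSymNest (toSite r) Lc 1)) K) (piKSymNest (toSite r) Lc 1) x z (Sum.inl a) (Sum.inl b) := by
  -- both sides as the right window contraction of the left-dressed kernel
  have two : ∀ M : ℕ, comp (comp (trK (piKSymNest (toSite r) Lc M)) K) (piKSymNest (toSite r) Lc M) x z (Sum.inl a) (Sum.inl b)
      = symAxProjNestAt (toSite r) Lc M (fun l q => comp (trK (piKSymNest (toSite r) Lc M)) K x q (Sum.inl a) (Sum.inl l)) b z := by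
    intro M
    rw [coDressNest_ff_apply, symAxProjNestAt_eq_coProjNestAt hLc hr,
      ← window_reorder (cube (d + 1) (Lc ^ M)) (cube (d + 1) (Lc ^ M))
        (fun v κ w l => pmSymNest (toSite r) Lc M a x κ (x - v) * K (x - v) (z - w) (Sum.inl κ) (Sum.inl l))
        (fun w l => pmSymNest (toSite r) Lc M b z l (z - w))]
    simp only [coProjNestAt, dressNestLeft_apply]
    exact Finset.sum_congr rfl fun w _ => Finset.sum_congr rfl fun l _ => mul_comm _ _
  -- the left-dressed kernel's second field leg is `𝒬`-killed, so `Π^{(m+1)} = Π^{(1)}` on it; then the left dressings agree leg by leg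
  have hF : (fun l q => comp (trK (piKSymNest (toSite r) Lc (m + 1))) K x q (Sum.inl a) (Sum.inl l))
      = fun l q => comp (trK (piKSymNest (toSite r) Lc 1)) K x q (Sum.inl a) (Sum.inl l) := by
    funext l q
    exact dressNestLeft_succ_eq_one_of_contourSum hLc hr m K q (Sum.inl l) (hK₁ q l) x a
  rw [two (m + 1), two 1, symAxProjNestAt_succ_eq_one_of_contourSum_eq_zero _ _ _ (contourSum_dressNestLeft_snd_eq_zero _ _ _ K hK₂ x a), hF]

end Form

/-! ## §2 The one-step resolvent's field legs are `𝒬_{Lc}`-killed on the step-`j` lattice (every `j`, any leg-type-constant units) -/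

section Resolvent

variable (Lc : ℕ) [NeZero Lc]

/-- [folklore] The FIRST field leg of the (unit-rescaled) decimated one-step resolvent `U KTot_{(j,1)}` is killed by the straight `Lc`-block averaging of the step-`j` lattice:
`Σ_i Γ_N(κ, p_i(q); l, P)` summed over the `Lc`-contour of `q` is the `Lc^(j+1) = N`-contour sum of the covariance column, `= 0` by `Gam_Q`. -/
theorem contourSum_KTot_one_fst_eq_zero (hLc : 1 ≤ Lc) (j : ℕ) (uf um : ℝ) (y' : Site (d + 1)) (l : Fin (d + 1)) :
    contourSum Lc (fun κ q => unitK uf um (KTot (d := d) (Lc ^ (j + 1)) (Lc ^ j)) q y' (Sum.inl κ) (Sum.inl l)) = 0 := by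
  have hM : 0 < Lc ^ j := pow_pos (by omega) j
  funext κ Y
  show contourSum Lc (fun κ q => unitK uf um (OneStepKernelFamily.dec (Lc ^ j) (KInv (N := Lc ^ (j + 1)) (d := d))) q y' (Sum.inl κ) (Sum.inl l)) κ Y = 0
  simp only [unitK_apply, legScale_inl, dec_inl_inl, KInv_inl_inl]
  -- pull the constants and the second-leg sum out; the first-leg sum is a `Lc^j`-contour sum
  have e : (fun κ q => uf * (∑ i ∈ LegIdx d (Lc ^ j), ∑ i' ∈ LegIdx d (Lc ^ j), (((Lc ^ j : ℕ) : ℝ) ^ (d + 2))⁻¹ * (((Lc ^ j : ℕ) : ℝ) ^ (d + 2))⁻¹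
        * Gam (N := Lc ^ (j + 1)) κ (legPt (Lc ^ j) (Sum.inl κ : Fib d) q i) l (legPt (Lc ^ j) (Sum.inl l : Fib d) y' i')) * uf)
      = fun κ q => ∑ i' ∈ LegIdx d (Lc ^ j), (uf * uf * ((((Lc ^ j : ℕ) : ℝ) ^ (d + 2))⁻¹ * (((Lc ^ j : ℕ) : ℝ) ^ (d + 2))⁻¹))
        * contourSum (Lc ^ j) (fun κ p => Gam (N := Lc ^ (j + 1)) κ p l (legPt (Lc ^ j) (Sum.inl l : Fib d) y' i')) κ q := by
    funext κ q
    rw [Finset.sum_comm]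
    simp only [← sum_LegIdx_eq_contourSum, Finset.mul_sum, Finset.sum_mul]
    refine Finset.sum_congr rfl fun i' _ => Finset.sum_congr rfl fun i _ => ?_
    ring
  rw [e, contourSum_finset_sum]
  refine Finset.sum_eq_zero fun i' _ => ?_
  rw [contourSum_const_mul, ← congrFun (congrFun (contourSum_mul (Lc ^ j) Lc hM _) κ) Y, ← pow_succ, Gam_Q, mul_zero]

/-- [folklore] … and so is the SECOND field leg (`Gam_symm`). -/
theorem contourSum_KTot_one_snd_eq_zero (hLc : 1 ≤ Lc) (j : ℕ) (uf um : ℝ) (x' : Site (d + 1)) (κ : Fin (d + 1)) :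
    contourSum Lc (fun l q => unitK uf um (KTot (d := d) (Lc ^ (j + 1)) (Lc ^ j)) x' q (Sum.inl κ) (Sum.inl l)) = 0 := by
  have hM : 0 < Lc ^ j := pow_pos (by omega) j
  funext l Y
  show contourSum Lc (fun l q => unitK uf um (OneStepKernelFamily.dec (Lc ^ j) (KInv (N := Lc ^ (j + 1)) (d := d))) x' q (Sum.inl κ) (Sum.inl l)) l Y = 0
  simp only [unitK_apply, legScale_inl, dec_inl_inl, KInv_inl_inl]
  have e : (fun l q => uf * (∑ i ∈ LegIdx d (Lc ^ j), ∑ i' ∈ LegIdx d (Lc ^ j), (((Lc ^ j : ℕ) : ℝ) ^ (d + 2))⁻¹ * (((Lc ^ j : ℕ) : ℝ) ^ (d + 2))⁻¹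
        * Gam (N := Lc ^ (j + 1)) κ (legPt (Lc ^ j) (Sum.inl κ : Fib d) x' i) l (legPt (Lc ^ j) (Sum.inl l : Fib d) q i')) * uf)
      = fun l q => ∑ i ∈ LegIdx d (Lc ^ j), (uf * uf * ((((Lc ^ j : ℕ) : ℝ) ^ (d + 2))⁻¹ * (((Lc ^ j : ℕ) : ℝ) ^ (d + 2))⁻¹))
        * contourSum (Lc ^ j) (fun l p => Gam (N := Lc ^ (j + 1)) l p κ (legPt (Lc ^ j) (Sum.inl κ : Fib d) x' i)) l q := by
    funext l q
    simp only [← sum_LegIdx_eq_contourSum, Finset.mul_sum, Finset.sum_mul]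
    refine Finset.sum_congr rfl fun i _ => Finset.sum_congr rfl fun i' _ => ?_
    rw [Gam_symm]
    ring
  rw [e, contourSum_finset_sum]
  refine Finset.sum_eq_zero fun i _ => ?_
  rw [contourSum_const_mul, ← congrFun (congrFun (contourSum_mul (Lc ^ j) Lc hM _) l) Y, ← pow_succ, Gam_Q, mul_zero]

end Resolvent

/-! ## §3 SPLIT (ii) for the field legs: at every `j`, and at the perfect one-step resolvent -/

section Perfect

variable (Lc : ℕ) [NeZero Lc]

/-- [our proof] **N-FINE AT EVERY FINITE `j`, LEFT** (every `d`, `Lc ≥ 1`, in-block root, any leg-type-constant units `unitK uf um`): on a field column of the rescaled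
one-step resolvent, `[Π̂_{m+1}·U KTot_{(j,1)}](x, y′; inl a, inl l) = [Π̂₁·U KTot_{(j,1)}](x, y′; inl a, inl l)` (`Π̂_M := piKSymNest (toSite r) Lc M`). -/
theorem dressNestLeft_unitKTot_one_succ_eq (hLc : 1 ≤ Lc) {r : Fin (d + 1) → ℕ} (hr : r ∈ box (d + 1) Lc) (m j : ℕ) (uf um : ℝ)
    (x y' : Site (d + 1)) (a l : Fin (d + 1)) :
    comp (trK (piKSymNest (toSite r) Lc (m + 1))) (unitK uf um (KTot (d := d) (Lc ^ (j + 1)) (Lc ^ j))) x y' (Sum.inl a) (Sum.inl l)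
      = comp (trK (piKSymNest (toSite r) Lc 1)) (unitK uf um (KTot (d := d) (Lc ^ (j + 1)) (Lc ^ j))) x y' (Sum.inl a) (Sum.inl l) :=
  dressNestLeft_succ_eq_one_of_contourSum hLc hr m _ y' (Sum.inl l) (contourSum_KTot_one_fst_eq_zero Lc hLc j uf um y' l) x a

/-- [our proof] **N-FINE AT EVERY FINITE `j`, TWO-SIDED** (every `d`, `Lc ≥ 1`, in-block root): the field–field block of the co-dressed rescaled one-step resolvent is the
same for `Π̂_{m+1}` and for `Π̂₁`. -/
theorem coDressNest_unitKTot_one_succ_ff_eq (hLc : 1 ≤ Lc) {r : Fin (d + 1) → ℕ} (hr : r ∈ box (d + 1) Lc) (m j : ℕ) (uf um : ℝ)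
    (x z : Site (d + 1)) (a b : Fin (d + 1)) :
    comp (comp (trK (piKSymNest (toSite r) Lc (m + 1))) (unitK uf um (KTot (d := d) (Lc ^ (j + 1)) (Lc ^ j)))) (piKSymNest (toSite r) Lc (m + 1))
        x z (Sum.inl a) (Sum.inl b)
      = comp (comp (trK (piKSymNest (toSite r) Lc 1)) (unitK uf um (KTot (d := d) (Lc ^ (j + 1)) (Lc ^ j)))) (piKSymNest (toSite r) Lc 1)
        x z (Sum.inl a) (Sum.inl b) :=
  coDressNest_ff_succ_eq_one_of_contourSum hLc hr m _ (fun y' l => contourSum_KTot_one_fst_eq_zero Lc hLc j uf um y' l)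
    (fun x' κ => contourSum_KTot_one_snd_eq_zero Lc hLc j uf um x' κ) x z a b

/-- [our proof] **SPLIT (ii) «N-FINE», LEFT, AT THE PERFECT ONE-STEP RESOLVENT — UNCONDITIONAL** (`d + 1 = 4`, `Lc ≥ 2`, in-block root `r ∈ box 4 Lc`, road units): on every
field column `[Π̂_{m+1}·KPerf 1](x, y′; inl a, inl l) = [Π̂₁·KPerf 1](x, y′; inl a, inl l)` — gan24-leaf-05's `dressNestLeft_KPerf_one_eq_holds` with its `h` supplied AT EVERY `j`. -/
theorem dressNestLeft_KPerf_one_succ_eq (hLc : 2 ≤ Lc) {r : Fin (3 + 1) → ℕ} (hr : r ∈ box (3 + 1) Lc) (m : ℕ) (x y' : Site (3 + 1)) (a l : Fin (3 + 1)) :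
    comp (trK (piKSymNest (toSite r) Lc (m + 1))) (KPerf (d := 3) Lc (sfStep Lc) (smStep 3 Lc) 1) x y' (Sum.inl a) (Sum.inl l)
      = comp (trK (piKSymNest (toSite r) Lc 1)) (KPerf (d := 3) Lc (sfStep Lc) (smStep 3 Lc) 1) x y' (Sum.inl a) (Sum.inl l) :=
  dressNestLeft_KPerf_one_eq_holds Lc hLc (toSite r) (toSite r) (m + 1) 1 x y' a a (Sum.inl l)
    (Eventually.of_forall fun j => dressNestLeft_unitKTot_one_succ_eq Lc (by omega) hr m j _ _ x y' a l)

/-- [our proof] The same with an2's one-step kernel `piKSymBm` (the literal's `Π̂₁`, FILE 4 `piKSymNest_one`) on the right. -/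
theorem dressNestLeft_KPerf_one_succ_eq_piKSymBm (hLc : 2 ≤ Lc) {r : Fin (3 + 1) → ℕ} (hr : r ∈ box (3 + 1) Lc) (m : ℕ) (x y' : Site (3 + 1))
    (a l : Fin (3 + 1)) :
    comp (trK (piKSymNest (toSite r) Lc (m + 1))) (KPerf (d := 3) Lc (sfStep Lc) (smStep 3 Lc) 1) x y' (Sum.inl a) (Sum.inl l)
      = comp (trK (piKSymBm (toSite r) Lc)) (KPerf (d := 3) Lc (sfStep Lc) (smStep 3 Lc) 1) x y' (Sum.inl a) (Sum.inl l) := by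
  rw [dressNestLeft_KPerf_one_succ_eq Lc hLc hr, piKSymNest_one]

/-- [our proof] **SPLIT (ii) «N-FINE», TWO-SIDED, AT THE PERFECT ONE-STEP RESOLVENT — UNCONDITIONAL** (`d + 1 = 4`, `Lc ≥ 2`, in-block root): the field–field block
`[Π̂_{m+1}·KPerf 1·Π̂_{m+1}ᵀ](x, z; inl a, inl b) = [Π̂₁·KPerf 1·Π̂₁ᵀ](x, z; inl a, inl b)` — the `KPerf 1`-part of `G_N = coDress_{Π^{(m+1)}}(KPerf (m+1))` IS the
literal's one-step-dressed `[coDress_{Π̂₁}(KPerf 1)]_ff` (memo §11 (11b) (ii)); gan24-leaf-05's `coDressNest_KPerf_one_ff_eq_holds` with its `h` supplied AT EVERY `j`. -/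
theorem coDressNest_KPerf_one_succ_ff_eq (hLc : 2 ≤ Lc) {r : Fin (3 + 1) → ℕ} (hr : r ∈ box (3 + 1) Lc) (m : ℕ) (x z : Site (3 + 1)) (a b : Fin (3 + 1)) :
    comp (comp (trK (piKSymNest (toSite r) Lc (m + 1))) (KPerf (d := 3) Lc (sfStep Lc) (smStep 3 Lc) 1)) (piKSymNest (toSite r) Lc (m + 1))
        x z (Sum.inl a) (Sum.inl b)
      = comp (comp (trK (piKSymNest (toSite r) Lc 1)) (KPerf (d := 3) Lc (sfStep Lc) (smStep 3 Lc) 1)) (piKSymNest (toSite r) Lc 1)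
        x z (Sum.inl a) (Sum.inl b) :=
  coDressNest_KPerf_one_ff_eq_holds Lc hLc (toSite r) (toSite r) (m + 1) 1 x z a b a b
    (Eventually.of_forall fun j => coDressNest_unitKTot_one_succ_ff_eq Lc (by omega) hr m j _ _ x z a b)

/-- [our proof] The same with an2's `piKSymBm` on the right (the literal's `coDressKSymAt` shape). -/
theorem coDressNest_KPerf_one_succ_ff_eq_piKSymBm (hLc : 2 ≤ Lc) {r : Fin (3 + 1) → ℕ} (hr : r ∈ box (3 + 1) Lc) (m : ℕ) (x z : Site (3 + 1))
    (a b : Fin (3 + 1)) :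
    comp (comp (trK (piKSymNest (toSite r) Lc (m + 1))) (KPerf (d := 3) Lc (sfStep Lc) (smStep 3 Lc) 1)) (piKSymNest (toSite r) Lc (m + 1))
        x z (Sum.inl a) (Sum.inl b)
      = comp (comp (trK (piKSymBm (toSite r) Lc)) (KPerf (d := 3) Lc (sfStep Lc) (smStep 3 Lc) 1)) (piKSymBm (toSite r) Lc)
        x z (Sum.inl a) (Sum.inl b) := by
  rw [coDressNest_KPerf_one_succ_ff_eq Lc hLc hr, piKSymNest_one]

end Perfect

end Summit.QuantumFields.BalabanUV.Beta.FP.NestedDressingFineLeg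

end
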